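import Literature.IUT.HodgeArakelov.AbsTopMonoidsGenuineOfSettingPadicClosure
import Literature.IUT.HodgeArakelov.AbsTopMonoidsGenuineIsometriesProofs
import HarnessLib

/-!
# [IUTchII] Example 1.8 (ii)–(iv) at the GENUINE setting over `(K, ℚ̄_p, ε = id)`: an ALL-FIELDS-GENUINE
# `AbsTopMonoids` (genuine `Ism(G)` and `Ẑ^× ↠ ℤ_p^× ↪ Ism(G)`), proof-only

S. Mochizuki, *Inter-universal Teichmüller theory II*, §1, Example 1.8 (ii)–(iv), kurims manuscript (Dec. 2020)
pp. 36–39 [claim: Mochizuki2012, status: disputed] (IUTchII §1 Ex 1.8 (iv), kurims p.39): "`Ism(G)` … the compact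
topological group of `G`-isometries of `O^{×μ}(G)` … the natural homomorphism `Ẑ^× ↠ ℤ_p^× ↪ Ism`"; Remark 1.11.1 (i)
(d) p. 50.  abc-iut cell, layer L6, NV register row «AbsTopMonoids at the genuine setting»; seat abc-iut-L6-d2 (gen 5).
PROOF-ONLY sequel of abc-iut-w5-d233's `AbsTopMonoidsGenuineOfSettingPadicClosure.lean` (p431000: the GENUINE-mod-`ε`
producer `genuineOfDoubleUnderlinePadic` at `S = ThetaSetting.ofDoubleUnderline …` over `(K, ℚ̄_p)` with the choice-free
`ε = galoisEpsilonPadic`, `Ism` degenerate) and this seat's `AbsTopMonoidsGenuineIsometries(Proofs).lean`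
(p427597/p427983: `genuineOfModelIsm`, genuine `Ism`/`toIsm`, `Rmk1111_d`).

* `AbsTopMonoids.exists_allGenuine_ofDoubleUnderlinePadic` — at the genuine setting, under (H1) `hΔ` and (H2) `hq`,
  there is an `AbsTopMonoids` with `O^⊳(G) = 𝒪^⊳_{ℚ̄_p}`, `Ism(G)` = print's isometry group of its own `G ↷ O^×(G)`
  w.r.t. the open subgroups (`AbsTopMonoids.ism`), `−1 ∈ Ẑ^×` acting by INVERSION on `O^{×μ}(G)`, and satisfying
  abc-iut-L6-t1's `Rmk1111_d` — namely `genuineOfModelIsm` at `(K, ℚ̄_p, ε = id)`;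
* `AbsTopMonoids.exists_allGenuine_ofDoubleUnderlinePadic_of_isOpenMap` — the same with (H2) from «`Π^tp_X → G_K` open».

HONEST FRAMING: record-only under a disputed claim key; nothing here bears on [IUTchIII] Cor. 3.12; typed ≠ proved
elsewhere; `Rmk181_statement` at this producer is conditional (GAP G-L6d2-1), not claimed here.
-/

set_option autoImplicit false

noncomputable section

namespace Literature.IUT.HodgeArakelov

open CategoryTheory
open Literature.AnabelianGeometry.AbsoluteAnabelian
open Literature.AnabelianGeometry.EtaleTheta Literature.AnabelianGeometry.SemiGraphs
open scoped Literature.AnabelianGeometry.EtaleTheta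

namespace AbsTopMonoids

variable {p : ℕ} [Fact p.Prime] {D : Literature.AnabelianGeometry.EtaleTheta.ThetaSetting p}
  {ED : D.EtaleThetaData} {l : ℕ} (C : ED.DoubleUnderline l) {N : ℕ+} (μ : D.CyclotomeMod l N)
  (hC : D.Compat) (hS : D.Sec2Hyps) (hl : l.Prime) (hp2 : p ≠ 2) (hpl : p ≠ l)
  (hζ : ∃ ζ : D.K, IsPrimitiveRoot ζ (4 * l)) {η : (C.thetaEnvData μ hC hS).PiYdd → MuN p N}
  (hη : η ∈ (C.thetaEnvData μ hC hS).thetaCocycles)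

/-- **An ALL-FIELDS-GENUINE `AbsTopMonoids` at the genuine setting over `(K, ℚ̄_p, ε = id)`** ([IUTchII] Ex. 1.8
(ii)–(iv)): under (H1) `hΔ` and (H2) `hq`, `genuineOfModelIsm` at `S = ofDoubleUnderline C μ …`, `(K, ℚ̄_p)`,
`ε = galoisEpsilonPadic` has `O^⊳(G) = 𝒪^⊳_{ℚ̄_p}`, `Ism(G)` = print's isometry group of `G ↷ O^×(G)` (open subgroups),
`−1 ∈ Ẑ^×` acting on `O^{×μ}(G)` by inversion (so `Ẑ^× → Ism(G)` is not trivial), and satisfies `Rmk1111_d`.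
[claim: Mochizuki2012, status: disputed] (IUTchII §1 Ex 1.8 (iv), kurims p.39) -/
theorem exists_allGenuine_ofDoubleUnderlinePadic
    (hΔ : ∀ f : (ThetaSetting.ofDoubleUnderline C μ hC hS hl hp2 hpl hζ hη).PiX ≃ₜ*
        (ThetaSetting.ofDoubleUnderline C μ hC hS hl hp2 hpl hζ hη).PiX,
      (ThetaSetting.ofDoubleUnderline C μ hC hS hl hp2 hpl hζ hη).DeltaX.map f.toMulEquiv.toMonoidHom =
        (ThetaSetting.ofDoubleUnderline C μ hC hS hl hp2 hpl hζ hη).DeltaX)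
    (hq : Nonempty (TopGroup.quot (ThetaSetting.ofDoubleUnderline C μ hC hS hl hp2 hpl hζ hη).PiX
        (ThetaSetting.ofDoubleUnderline C μ hC hS hl hp2 hpl hζ hη).DeltaX ≃ₜ*
        (ThetaSetting.ofDoubleUnderline C μ hC hS hl hp2 hpl hζ hη).Gk)) :
    ∃ A : AbsTopMonoids (ThetaSetting.ofDoubleUnderline C μ hC hS hl hp2 hpl hζ hη),
      (∀ G, A.Otri G =
        (ModelMLFGaloisData.galois D.toTemperedCurve.mlfClosurePadic.k D.toTemperedCurve.mlfClosurePadic.K).tmPair.M) ∧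
      (∀ G, A.Ism G = ↥(A.ism G)) ∧
      (∀ (G : IsoClass (ThetaSetting.ofDoubleUnderline C μ hC hS hl hp2 hpl hζ hη).Gk) (x : A.Oxmu G),
        A.actIsm G (A.toIsm G ZHatLevel.negOneAut) x = x⁻¹) ∧
      Rmk1111_d A :=
  ⟨genuineOfModelIsm (ThetaSetting.ofDoubleUnderline C μ hC hS hl hp2 hpl hζ hη) D.toTemperedCurve.mlfClosurePadic
      D.toTemperedCurve.galoisEpsilonPadic hΔ hq,
    fun _ => rfl, fun _ => rfl,
    fun G x => actIsm_toIsm_negOneAut _ _ _ hΔ hq G x,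
    rmk1111_d_genuineOfModelIsm _ _ _ hΔ hq⟩

/-- **The same with (H2) from «`Π^tp_X → G_K` open»** (w5-d105's `quotDeltaX_iso_of_isOpenMap` through the open
`Π^tp_{X̲̲} ≤ Π^tp_X`, as in abc-iut-w5-d233's `genuineOfDoubleUnderlinePadic_of_isOpenMap`).
[claim: Mochizuki2012, status: disputed] (IUTchII §1 Ex 1.8 (iv), kurims p.39) -/
theorem exists_allGenuine_ofDoubleUnderlinePadic_of_isOpenMap
    (hopen : IsOpenMap fun x : D.PiTemp => (⟨D.aug x, D.aug_mem_GK x⟩ : D.GK))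
    (hΔ : ∀ f : (ThetaSetting.ofDoubleUnderline C μ hC hS hl hp2 hpl hζ hη).PiX ≃ₜ*
        (ThetaSetting.ofDoubleUnderline C μ hC hS hl hp2 hpl hζ hη).PiX,
      (ThetaSetting.ofDoubleUnderline C μ hC hS hl hp2 hpl hζ hη).DeltaX.map f.toMulEquiv.toMonoidHom =
        (ThetaSetting.ofDoubleUnderline C μ hC hS hl hp2 hpl hζ hη).DeltaX) :
    ∃ A : AbsTopMonoids (ThetaSetting.ofDoubleUnderline C μ hC hS hl hp2 hpl hζ hη),
      (∀ G, A.Otri G =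
        (ModelMLFGaloisData.galois D.toTemperedCurve.mlfClosurePadic.k D.toTemperedCurve.mlfClosurePadic.K).tmPair.M) ∧
      (∀ G, A.Ism G = ↥(A.ism G)) ∧
      (∀ (G : IsoClass (ThetaSetting.ofDoubleUnderline C μ hC hS hl hp2 hpl hζ hη).Gk) (x : A.Oxmu G),
        A.actIsm G (A.toIsm G ZHatLevel.negOneAut) x = x⁻¹) ∧
      Rmk1111_d A :=
  exists_allGenuine_ofDoubleUnderlinePadic C μ hC hS hl hp2 hpl hζ hη hΔ
    (quotDeltaX_iso_of_isOpenMap _ (hopen.comp C.isOpen_Huu.isOpenMap_subtype_val))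

end AbsTopMonoids

end Literature.IUT.HodgeArakelov

end
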